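import Mathlib
import Summits.AtomisticToContinuum.HydrodynamicLimit.Theorems.ImplosionDichotomyDenseExcursionSonicSmoothBranchCkSonicPair
import Summits.AtomisticToContinuum.HydrodynamicLimit.Theorems.ImplosionDichotomyDenseExcursionSonicSmoothBranchCkExist
import Summits.AtomisticToContinuum.HydrodynamicLimit.Theorems.ImplosionDichotomyDenseExcursionSonicSmoothBranchCkUnique

/-!
# The smooth branch of the characteristic system of a tube profile at the sonic point: existence, bound, uniqueness
# (crux `DenseExcursion`, line `sonic-cavity-renewal`, brick for stub `stub_cavityResolventCk`, theorem T2)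

Helper file (`--supports stmt-AtomisticToContinuum-12586`, line lead a2, stub-worker W4 for `stub_cavityResolventCk`).
The characteristic form of the resolvent equation at the repulsive sonic point `x = 0` of a tube profile,
  `c₊ p′ = (Λ − b₊₊)p − b₊₋ q − σ_p`,  `c₋ q′ = −b₋₊ p + (Λ − b₋₋)q − σ_q`,  `c₊ = W − 1 + S = x·η`, `c₋ = W − 1 − S`,
for `‖Λ‖ ≤ R`, `Re ν(Λ) ≤ k − 1` (`ν = (b₊₊(0) − Λ)/κ`), `|Im Λ| ≥ 1` and smooth sources, has on a `Λ`-independent interval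
`(−δ, δ)` a `C^∞` solution with prescribed `q(0) = q₀` and `‖p‖ + ‖q‖ ≤ K(‖q₀‖ + sup_{|y|≤|x|, j≤k}‖σ⁽ʲ⁾‖)`, `K = K(k, R,
profile)`, and `C^∞` solutions with the same `q(0)` coincide (registered helper `sonic_char_branch`). Assembly of
`sonic_frobenius_pair` (the analytic Frobenius pair, uniform in `Λ`), `singular_branch_exists` (variation of parameters +
scalar Euler solver) and `singular_branch_unique`, via the division `x v′ = N v + t` ↔ characteristic form (`η ≠ 0`,
`c₋ ≠ 0`; at `x = 0` the `q`-row holds by continuity). Sources: Coddington–Levinson 1955 Ch. 4 (folklore).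
-/

noncomputable section

open Set Filter
open scoped Topology ContDiff

namespace Summit.AtomisticToContinuum.HydrodynamicLimit.Theorems.SonicCavityRenewal

open Summit.AtomisticToContinuum.HydrodynamicLimit.Theorems.R2OneModeTwoConditions

/-- A continuous function on an open interval around `0` which vanishes off `0` vanishes at `0`. [folklore] -/
theorem eq_zero_of_eq_zero_off_zero {Φ : ℝ → ℂ} {ρ : ℝ} (hρ : 0 < ρ) (hc : ContinuousAt Φ 0)
    (h : ∀ y ∈ Ioo (-ρ) ρ, y ≠ 0 → Φ y = 0) : Φ 0 = 0 := by
  have h1 : Tendsto Φ (𝓝[≠] (0 : ℝ)) (𝓝 (Φ 0)) := hc.tendsto.mono_left nhdsWithin_le_nhds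
  have h2 : Tendsto Φ (𝓝[≠] (0 : ℝ)) (𝓝 0) := by
    refine tendsto_const_nhds.congr' (eventually_nhdsWithin_iff.2 ?_)
    filter_upwards [isOpen_Ioo.mem_nhds (show (0 : ℝ) ∈ Ioo (-ρ) ρ from ⟨by linarith, hρ⟩)] with y hy hy0
    exact (h y hy hy0).symm
  exact tendsto_nhds_unique h1 h2

/-- **Registered helper `sonic_char_branch`: THE SMOOTH BRANCH OF THE CHARACTERISTIC SYSTEM AT THE SONIC POINT OF A TUBE
PROFILE — existence with a `C^k → C⁰` estimate uniform on bounded `Λ`-sets, and uniqueness.** See the module docstring.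
[folklore] -/
theorem sonic_char_branch : ∀ (r : ℝ) (W S : ℝ → ℝ), IsMonatomicProfile r W S → CavityTube r W S → ∀ (k : ℕ) (R : ℝ), ∃ δ : ℝ, 0 < δ ∧ δ ≤ 1 ∧ ∃ K : ℝ, 0 < K ∧ ∀ Λ : ℂ, ‖Λ‖ ≤ R → ((((2 / 3 * deriv W 0 + 2 * deriv S 0 + 2 * W 0 + 4 * S 0 - r : ℝ) : ℂ) - Λ) / ((-(deriv W 0 + deriv S 0) : ℝ) : ℂ)).re ≤ (k : ℝ) - 1 → 1 ≤ |Λ.im| → ∀ (σp σq : ℝ → ℂ), ContDiff ℝ ∞ σp → ContDiff ℝ ∞ σq → ∀ q₀ : ℂ, (∃ p q : ℝ → ℂ, ContDiffOn ℝ ∞ p (Set.Ioo (-δ) δ) ∧ ContDiffOn ℝ ∞ q (Set.Ioo (-δ) δ) ∧ q 0 = q₀ ∧ (∀ x ∈ Set.Ioo (-δ) δ, ((W x - 1 + S x : ℝ) : ℂ) * deriv p x = (Λ - ((2 / 3 * deriv W x + 2 * W x - r + 2 * deriv S x + 4 * S x : ℝ) : ℂ)) * p x - ((deriv W x / 3 +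 deriv S x + 2 * S x : ℝ) : ℂ) * q x - σp x ∧ ((W x - 1 - S x : ℝ) : ℂ) * deriv q x = -((deriv W x / 3 - deriv S x - 2 * S x : ℝ) : ℂ) * p x + (Λ - ((2 / 3 * deriv W x + 2 * W x - r - 2 * deriv S x - 4 * S x : ℝ) : ℂ)) * q x - σq x) ∧ ∀ x ∈ Set.Ioo (-δ) δ, ∀ M : ℝ, (∀ y ∈ Set.Icc (-|x|) |x|, ∀ j : ℕ, j ≤ k → ‖iteratedDeriv j σp y‖ ≤ M ∧ ‖iteratedDeriv j σq y‖ ≤ M) → ‖p x‖ + ‖q x‖ ≤ K * (‖q₀‖ + M)) ∧ (∀ p q p' q' : ℝ → ℂ, ContDiffOn ℝ ∞ p (Set.Ioo (-δ) δ) → ContDiffOn ℝ ∞ q (Set.Ioo (-δ) δ) → ContDiffOn ℝ ∞ p' (Set.Ioo (-δ) δ) → ContDiffOn ℝ ∞ q' (Set.Ioo (-δ) δ) → (∀ x ∈ Set.Ioo (-δ) δ, ((W x - 1 + S x : ℝ) : ℂ) * deriv p x = (Λ - ((2 / 3 * deriv W x + 2 * W x - r + 2 * deriv S x + 4 * S x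 : ℝ) : ℂ)) * p x - ((deriv W x / 3 + deriv S x + 2 * S x : ℝ) : ℂ) * q x - σp x ∧ ((W x - 1 - S x : ℝ) : ℂ) * deriv q x = -((deriv W x / 3 - deriv S x - 2 * S x : ℝ) : ℂ) * p x + (Λ - ((2 / 3 * deriv W x + 2 * W x - r - 2 * deriv S x - 4 * S x : ℝ) : ℂ)) * q x - σq x) → (∀ x ∈ Set.Ioo (-δ) δ, ((W x - 1 + S x : ℝ) : ℂ) * deriv p' x = (Λ - ((2 / 3 * deriv W x + 2 * W x - r + 2 * deriv S x + 4 * S x : ℝ) : ℂ)) * p' x - ((deriv W x / 3 + deriv S x + 2 * S x : ℝ) : ℂ) * q' x - σp x ∧ ((W x - 1 - S x : ℝ) : ℂ) * deriv q' x = -((deriv W x / 3 - deriv S x - 2 * S x : ℝ) : ℂ) * p' x + (Λ - ((2 / 3 * deriv W x + 2 * W x - r - 2 * deriv S x - 4 * S x : ℝ) : ℂ)) * q' x - σq x) → q 0 = q' 0 → Set.EqOn p p' (Set.Ioo (-δ) δ) ∧ Set.EqOn q q' (Set.Ioo (-δ) δ)) := by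
  intro r W S hP hT k R
  obtain ⟨ρ, hρ, hρ1, hxη, hη0, hκ, hκ', hne, Cb, hCb, ⟨ι₁, ι₂, hι₁, hι₂, hιeq, hιb⟩, hpairΛ⟩ :=
    sonic_frobenius_pair r W S hP hT k R
  obtain ⟨KF, hKF, hF⟩ := singular_branch_exists k Cb (4 / 7) hCb (by norm_num)
  obtain ⟨-, -, hW, hS, -, -, -, -, -⟩ := hP
  have hW1 : Differentiable ℝ W := hW.differentiable (by simp)
  have hS1 : Differentiable ℝ S := hS.differentiable (by simp)
  have hWc : Continuous (deriv W) := hW.continuous_deriv (by simp)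
  have hSc : Continuous (deriv S) := hS.continuous_deriv (by simp)
  have hU : IsOpen (Ioo (-ρ) ρ) := isOpen_Ioo
  have h0U : (0 : ℝ) ∈ Ioo (-ρ) ρ := ⟨by linarith, hρ⟩
  -- the exponent data
  have hsum0 : deriv W 0 + deriv S 0 ≠ 0 := by linarith
  have hsumC : ((-(deriv W 0 + deriv S 0) : ℝ) : ℂ) ≠ 0 := by exact_mod_cast (neg_ne_zero.2 hsum0)
  have hηC0 : ((dslope (fun y => W y - 1 + S y) 0 0 : ℝ) : ℂ) ≠ 0 := by rw [hη0]; exact_mod_cast hsum0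
  -- the continuity of `η` on the interval
  have hηcont : ContinuousOn (dslope (fun y => W y - 1 + S y) 0) (Ioo (-ρ) ρ) :=
    (continuousOn_dslope (hU.mem_nhds h0U)).2 ⟨((hW1.continuous.sub continuous_const).add hS1.continuous).continuousOn,
      ((hW1 0).sub_const 1).add (hS1 0)⟩
  refine ⟨ρ, hρ, hρ1, KF * (1 + 2 ^ k * Cb), by positivity, fun Λ hΛ hνre hΛi σp σq hσp hσq q₀ => ?_⟩
  obtain ⟨a₁, a₂, ψ₁, ψ₂, χ, ha₁, ha₂, hψ₁, hψ₂, hχ, ha₂0, hψ₁0, hψχ, hode, hWr, hbd⟩ := hpairΛ Λ hΛ hΛi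
  set ν : ℂ := ((((2 / 3 * deriv W 0 + 2 * deriv S 0 + 2 * W 0 + 4 * S 0 - r : ℝ) : ℂ) - Λ) /
    ((-(deriv W 0 + deriv S 0) : ℝ) : ℂ)) with hν
  have hνim : (4 / 7 : ℝ) ≤ |ν.im| := by
    have h1 : |ν.im| = |Λ.im| / (-(deriv W 0 + deriv S 0)) := by
      rw [hν, Complex.div_ofReal_im, Complex.sub_im, Complex.ofReal_im, zero_sub, abs_div, abs_neg,
        abs_of_pos (by linarith : (0 : ℝ) < -(deriv W 0 + deriv S 0))]
    rw [h1, le_div_iff₀ (by linarith)]; linarith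
  have hνi : ν.im ≠ 0 := fun h => by rw [h, abs_zero] at hνim; linarith
  -- the coefficient functions and their continuity
  set n₁₁ : ℝ → ℂ := fun x => (Λ - ((2 / 3 * deriv W x + 2 * W x - r + 2 * deriv S x + 4 * S x : ℝ) : ℂ)) /
    ((dslope (fun y => W y - 1 + S y) 0 x : ℝ) : ℂ) with hn₁₁
  set n₁₂ : ℝ → ℂ := fun x => -((deriv W x / 3 + deriv S x + 2 * S x : ℝ) : ℂ) /
    ((dslope (fun y => W y - 1 + S y) 0 x : ℝ) : ℂ) with hn₁₂
  set n₂₁ : ℝ → ℂ := fun x => -(x : ℂ) * ((deriv W x / 3 - deriv S x - 2 * S x : ℝ) : ℂ) / ((W x - 1 - S x : ℝ) : ℂ)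
    with hn₂₁
  set n₂₂ : ℝ → ℂ := fun x => (x : ℂ) * (Λ - ((2 / 3 * deriv W x + 2 * W x - r - 2 * deriv S x - 4 * S x : ℝ) : ℂ)) /
    ((W x - 1 - S x : ℝ) : ℂ) with hn₂₂
  have hn0 : n₁₁ 0 = ν := by
    have hs' : ((deriv W 0 : ℝ) : ℂ) + ((deriv S 0 : ℝ) : ℂ) ≠ 0 := by exact_mod_cast hsum0
    simp only [hn₁₁, hν, hη0]; push_cast; field_simp; ring
  have hcR : ∀ {f : ℝ → ℝ}, Continuous f → ContinuousOn (fun x => ((f x : ℝ) : ℂ)) (Ioo (-ρ) ρ) := fun hf =>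
    (Complex.continuous_ofReal.comp hf).continuousOn
  have hηR : ContinuousOn (fun x => ((dslope (fun y => W y - 1 + S y) 0 x : ℝ) : ℂ)) (Ioo (-ρ) ρ) :=
    Complex.continuous_ofReal.comp_continuousOn hηcont
  have hηne : ∀ x ∈ Ioo (-ρ) ρ, ((dslope (fun y => W y - 1 + S y) 0 x : ℝ) : ℂ) ≠ 0 := fun x hx =>
    Complex.ofReal_ne_zero.2 (hne x hx).1
  have hcne : ∀ x ∈ Ioo (-ρ) ρ, ((W x - 1 - S x : ℝ) : ℂ) ≠ 0 := fun x hx => Complex.ofReal_ne_zero.2 (hne x hx).2.ne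
  have hn₁₁c : ContinuousOn n₁₁ (Ioo (-ρ) ρ) :=
    (continuousOn_const.sub (hcR (by fun_prop))).div hηR hηne
  have hn₁₂c : ContinuousOn n₁₂ (Ioo (-ρ) ρ) := (hcR (by fun_prop)).neg.div hηR hηne
  have hn₂₁c : ContinuousOn n₂₁ (Ioo (-ρ) ρ) :=
    ((hcR continuous_id).neg.mul (hcR (by fun_prop))).div (hcR (by fun_prop)) hcne
  have hn₂₂c : ContinuousOn n₂₂ (Ioo (-ρ) ρ) :=
    ((hcR continuous_id).mul (continuousOn_const.sub (hcR (by fun_prop)))).div (hcR (by fun_prop)) hcne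
  -- the Wronskian does not vanish
  have hw : ∀ x ∈ Ioo (-ρ) ρ, a₁ x * ψ₂ x - a₂ x * ψ₁ x ≠ 0 := by
    intro x hx h
    have := hWr x hx; rw [h, zero_add, norm_one] at this; norm_num at this
  -- algebraic conversion tools
  have hcp : ∀ x : ℝ, ((W x - 1 + S x : ℝ) : ℂ) = (x : ℂ) * ((dslope (fun y => W y - 1 + S y) 0 x : ℝ) : ℂ) := fun x => by
    rw [← hxη x]; push_cast; ring
  constructor
  · -- EXISTENCE WITH THE ESTIMATE
    obtain ⟨p, q, hp, hq, hq0, hpq, hbound⟩ := hF ν ρ n₁₁ n₁₂ n₂₁ n₂₂ a₁ a₂ ψ₁ ψ₂ χ (fun x => -(σp x) * ι₁ x)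
      (fun x => -(σq x) * ι₂ x) q₀ hνre hνim hρ hρ1 ha₁ ha₂ hψ₁ hψ₂ hχ ha₂0 hψχ (fun x hx => (hode x hx).1)
      (fun x hx => (hode x hx).2) hWr hbd (hσp.contDiffOn.neg.mul hι₁) (hσq.contDiffOn.neg.mul hι₂)
    refine ⟨p, q, hp, hq, hq0, fun x hx => ?_, fun x hx M hM => ?_⟩
    · obtain ⟨e1, -⟩ := hpq x hx
      obtain ⟨i1, -⟩ := hιeq x hx
      have hη := hηne x hx
      have hinv₁ : ((dslope (fun y => W y - 1 + S y) 0 x : ℝ) : ℂ) * ((dslope (fun y => W y - 1 + S y) 0 x : ℝ) : ℂ)⁻¹ = 1 :=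
        mul_inv_cancel₀ hη
      simp only [hn₁₁, hn₁₂, i1] at e1
      push_cast at e1
      constructor
      · rw [hcp x]
        push_cast
        linear_combination ((dslope (fun y => W y - 1 + S y) 0 x : ℝ) : ℂ) * e1 +
          ((Λ - (2 / 3 * ((deriv W x : ℝ) : ℂ) + 2 * ((W x : ℝ) : ℂ) - ((r : ℝ) : ℂ) + 2 * ((deriv S x : ℝ) : ℂ) + 4 * ((S x : ℝ) : ℂ))) * p x -
            (((deriv W x : ℝ) : ℂ) / 3 + ((deriv S x : ℝ) : ℂ) + 2 * ((S x : ℝ) : ℂ)) * q x - σp x) * hinv₁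
      · -- the `q`-row: for `x ≠ 0` divide by `x`, at `x = 0` by continuity
        have key : ∀ y ∈ Ioo (-ρ) ρ, y ≠ 0 → ((W y - 1 - S y : ℝ) : ℂ) * deriv q y =
            -((deriv W y / 3 - deriv S y - 2 * S y : ℝ) : ℂ) * p y +
              (Λ - ((2 / 3 * deriv W y + 2 * W y - r - 2 * deriv S y - 4 * S y : ℝ) : ℂ)) * q y - σq y := by
          intro y hy hy0
          obtain ⟨-, f2⟩ := hpq y hy
          obtain ⟨-, j2⟩ := hιeq y hy
          have hc' : ((W y : ℝ) : ℂ) - 1 - ((S y : ℝ) : ℂ) ≠ 0 := by have := hcne y hy; push_cast at this; exact this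
          have hinv : (((W y : ℝ) : ℂ) - 1 - ((S y : ℝ) : ℂ)) * (((W y : ℝ) : ℂ) - 1 - ((S y : ℝ) : ℂ))⁻¹ = 1 := mul_inv_cancel₀ hc'
          simp only [hn₂₁, hn₂₂, j2] at f2
          push_cast at f2 ⊢
          have hy0' : (y : ℂ) ≠ 0 := Complex.ofReal_ne_zero.2 hy0
          refine mul_left_cancel₀ hy0' ?_
          linear_combination (((W y : ℝ) : ℂ) - 1 - ((S y : ℝ) : ℂ)) * f2 +
            ((y : ℂ) * (-(((deriv W y : ℝ) : ℂ) / 3 - ((deriv S y : ℝ) : ℂ) - 2 * ((S y : ℝ) : ℂ)) * p y +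
              (Λ - (2 / 3 * ((deriv W y : ℝ) : ℂ) + 2 * ((W y : ℝ) : ℂ) - ((r : ℝ) : ℂ) - 2 * ((deriv S y : ℝ) : ℂ) - 4 * ((S y : ℝ) : ℂ))) * q y -
                σq y)) * hinv
        rcases eq_or_ne x 0 with rfl | hx0
        · have hcont : ContinuousAt (fun y => ((W y - 1 - S y : ℝ) : ℂ) * deriv q y -
              (-((deriv W y / 3 - deriv S y - 2 * S y : ℝ) : ℂ) * p y +
                (Λ - ((2 / 3 * deriv W y + 2 * W y - r - 2 * deriv S y - 4 * S y : ℝ) : ℂ)) * q y - σq y)) 0 := by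
            have hpc : ContinuousAt p 0 := (hp.continuousOn 0 h0U).continuousAt (hU.mem_nhds h0U)
            have hqc : ContinuousAt q 0 := (hq.continuousOn 0 h0U).continuousAt (hU.mem_nhds h0U)
            have hdq : ContinuousAt (deriv q) 0 := (hq.continuousOn_deriv_of_isOpen hU (by simp) 0 h0U).continuousAt
              (hU.mem_nhds h0U)
            have hR : ∀ {f : ℝ → ℝ}, Continuous f → ContinuousAt (fun y => ((f y : ℝ) : ℂ)) 0 := fun hf =>
              (Complex.continuous_ofReal.comp hf).continuousAt
            exact ((hR (by fun_prop)).mul hdq).sub ((((hR (by fun_prop)).neg.mul hpc).add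
              ((continuousAt_const.sub (hR (by fun_prop))).mul hqc)).sub hσq.continuous.continuousAt)
          have := eq_zero_of_eq_zero_off_zero hρ hcont fun y hy hy0 => sub_eq_zero.2 (key y hy hy0)
          exact sub_eq_zero.1 this
        · exact key x hx hx0
    · -- the estimate: `τ`'s derivatives are bounded by `2^k M Cb`
      have hsub : Icc (-|x|) |x| ⊆ Ioo (-ρ) ρ := fun y hy => abs_lt.1 (lt_of_le_of_lt (abs_le.2 hy) (abs_lt.2 hx))
      have hM0 : 0 ≤ M := (norm_nonneg _).trans (hM 0 ⟨neg_nonpos.2 (abs_nonneg x), abs_nonneg x⟩ 0 (Nat.zero_le k)).1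
      have hcA : ∀ {f : ℝ → ℂ}, ContDiffOn ℝ ∞ f (Ioo (-ρ) ρ) → ∀ y ∈ Ioo (-ρ) ρ, ContDiffAt ℝ k f y := fun hf y hy =>
        ((hf y hy).contDiffAt (hU.mem_nhds hy)).of_le (by exact_mod_cast le_top)
      have hτ : ∀ y ∈ Icc (-|x|) |x|, ∀ j : ℕ, j ≤ k → ‖iteratedDeriv j (fun x => -(σp x) * ι₁ x) y‖ ≤ 2 ^ k * M * Cb ∧
          ‖iteratedDeriv j (fun x => -(σq x) * ι₂ x) y‖ ≤ 2 ^ k * M * Cb := by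
        intro y hy j hj
        have hyU := hsub hy
        have hA : ∀ {σ : ℝ → ℂ}, ContDiff ℝ ∞ σ → ContDiffAt ℝ k (fun x => -(σ x)) y := fun hσ =>
          (hσ.contDiffAt.of_le (by exact_mod_cast le_top)).neg
        refine ⟨norm_iteratedDeriv_mul_le_of_le' (hA hσp) (hcA hι₁ y hyU) hM0 (fun i hi => ?_)
          (fun i hi => (hιb i hi y hyU).1) j hj, norm_iteratedDeriv_mul_le_of_le' (hA hσq) (hcA hι₂ y hyU) hM0
          (fun i hi => ?_) (fun i hi => (hιb i hi y hyU).2) j hj⟩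
        · rw [iteratedDeriv_fun_neg, norm_neg]; exact (hM y hy i hi).1
        · rw [iteratedDeriv_fun_neg, norm_neg]; exact (hM y hy i hi).2
      have hfin : KF * (1 + 2 ^ k * Cb) * (‖q₀‖ + M) - KF * (‖q₀‖ + 2 ^ k * M * Cb) =
          KF * M + KF * (2 ^ k * Cb * ‖q₀‖) := by ring
      have hnn : 0 ≤ KF * M + KF * (2 ^ k * Cb * ‖q₀‖) := by positivity
      calc ‖p x‖ + ‖q x‖ ≤ KF * (‖q₀‖ + 2 ^ k * M * Cb) := hbound x hx _ hτ
        _ ≤ KF * (1 + 2 ^ k * Cb) * (‖q₀‖ + M) := by linarith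
  · -- UNIQUENESS
    intro p q p' q' hp hq hp' hq' h1 h2 hq00
    have hdf : ∀ {f : ℝ → ℂ}, ContDiffOn ℝ ∞ f (Ioo (-ρ) ρ) → ∀ y ∈ Ioo (-ρ) ρ, HasDerivAt f (deriv f y) y :=
      fun hf y hy => ((hf.differentiableOn (by simp)) y hy |>.differentiableAt (hU.mem_nhds hy)).hasDerivAt
    have key := singular_branch_unique ν k ρ n₁₁ n₁₂ n₂₁ n₂₂ a₁ a₂ ψ₁ ψ₂ (fun y => p y - p' y) (fun y => q y - q' y)
      hνre hνi hρ hn₁₁c hn₁₂c hn₂₁c hn₂₂c hn0 ha₁ ha₂ hψ₁ hψ₂ (fun x hx => (hode x hx).1) (fun x hx => (hode x hx).2)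
      ha₂0 hψ₁0 hw (hp.sub hp') (hq.sub hq') (fun x hx => ?_) (by simp [hq00])
    · exact ⟨fun x hx => sub_eq_zero.1 (key x hx).1, fun x hx => sub_eq_zero.1 (key x hx).2⟩
    · obtain ⟨e1, e2⟩ := h1 x hx
      obtain ⟨f1, f2⟩ := h2 x hx
      have hη := hηne x hx
      have hc : ((W x : ℝ) : ℂ) - 1 - ((S x : ℝ) : ℂ) ≠ 0 := by have := hcne x hx; push_cast at this; exact this
      have hinv₁ : ((dslope (fun y => W y - 1 + S y) 0 x : ℝ) : ℂ) * ((dslope (fun y => W y - 1 + S y) 0 x : ℝ) : ℂ)⁻¹ = 1 :=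
        mul_inv_cancel₀ hη
      have hinv₂ : (((W x : ℝ) : ℂ) - 1 - ((S x : ℝ) : ℂ)) * (((W x : ℝ) : ℂ) - 1 - ((S x : ℝ) : ℂ))⁻¹ = 1 := mul_inv_cancel₀ hc
      have dp : deriv (fun y => p y - p' y) x = deriv p x - deriv p' x := ((hdf hp x hx).sub (hdf hp' x hx)).deriv
      have dq : deriv (fun y => q y - q' y) x = deriv q x - deriv q' x := ((hdf hq x hx).sub (hdf hq' x hx)).deriv
      rw [dp, dq]
      rw [hcp x] at e1 f1
      simp only [hn₁₁, hn₁₂, hn₂₁, hn₂₂]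
      push_cast at e1 f1 e2 f2 ⊢
      constructor
      · linear_combination ((dslope (fun y => W y - 1 + S y) 0 x : ℝ) : ℂ)⁻¹ * (e1 - f1) +
          (-((x : ℂ) * (deriv p x - deriv p' x))) * hinv₁
      · linear_combination ((x : ℂ) * (((W x : ℝ) : ℂ) - 1 - ((S x : ℝ) : ℂ))⁻¹) * (e2 - f2) +
          (-((x : ℂ) * (deriv q x - deriv q' x))) * hinv₂

end Summit.AtomisticToContinuum.HydrodynamicLimit.Theorems.SonicCavityRenewal

end
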